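import Literature.Computability.Cryptography.AffineHashStrings
import Literature.Computability.Cryptography.InaccessibleEntropyPrefixHash
import HarnessLib

/-!
# Three-wise independence of affine hashing over `𝔽₂`, and the hashed prefixes of HHRVW 2020, Theorem 4.5

Topic `Literature/Computability/Cryptography` (with a short appendix to `Complexity/AffineHashing.lean`). Fourth
file of the "one-way functions ⇒ universal one-way hash functions" line (plan in
`InaccessibleEntropyPrefixHash.lean`). It supplies the concrete hash family behind the abstract counting
hypotheses `PrefixPairwise` / `PrefixThreewise` of Theorem 4.5 and `IsThreewiseIndep` of Lemma 5.4:

* `AffineHash.evalTripleHom_surjective`, `AffineHash.card_filter_hash_triple` — the affine family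
  `h_{A,b}(x) = Ax + b` over `𝔽₂` is **three-wise independent** (any three distinct vectors `(x,1)` are
  linearly independent over `𝔽₂`; constructively: match two points by `evalPairHom_surjective`, then
  correct at the third by a matrix vanishing on one nonzero difference vector and prescribed on the other,
  `exists_matrix_mulVec_eq_zero_eq`);
* string-keyed forms in the layout of `Stockmeyer.coinHash` / `AffineStr.hashV`:
  `AffineStr.card_filter_hashV_triple` (and `card_filter_hashV_pair`, the unfolded pairwise count);
* `HHRVW.prefixZ` (the `i`-prefix of a value of `𝔽₂^k`), `card_filter_prefixZ_eq_mul` (prefix classes have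
  `2^{k−i}` elements), and the passage from two-point or three-point uniformity of hash values to the `2^{−i}` /
  `4^{−i}` prefix-agreement counts (`card_filter_prefixZ_agree_mul`, `card_filter_prefixZ_agree_two_mul`);
* `HHRVW.affinePrefix P k ℓ pad σ i y = prefixZ i (h_σ (pad y))` and the instances
  `prefixPairwise_affinePrefix`, `prefixThreewise_affinePrefix` of the hypotheses of
  `InaccessibleEntropyPrefixHash.lean` (for `ℓ ≥ k(P+1)`, `M ≤ k+1`, `pad` injective on images).

All statements proved; no named facts. (The analogous `IsThreewiseIndep` instance for
`InaccessibleEntropyHashing.lean` is a one-line corollary of `card_filter_hashV_triple`, added where used.)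

## References

* J. L. Carter, M. N. Wegman, *Universal classes of hash functions*, JCSS 18 (1979) (the affine family).
* S. Arora, B. Barak, *Computational Complexity: A Modern Approach*, CUP 2009, Def. 8.14, Exercise 8.4.
* I. Haitner, T. Holenstein, O. Reingold, S. Vadhan, H. Wee, *Inaccessible Entropy II*, Theory of Computing
  16(8) (2020), §2.4 ("constructible families of t-wise independent functions"), Thm. 4.5, Claims 4.6, 4.8.
-/

namespace Literature.Computability.Complexity

namespace AffineHash

open Finset Matrix

variable {m k : ℕ}

/-- Evaluation at three points, as an additive homomorphism of `(A, b)`. [folklore] -/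
def evalTripleHom (x x' x'' : Fin m → ZMod 2) :
    Hash m k →+ (Fin k → ZMod 2) × (Fin k → ZMod 2) × (Fin k → ZMod 2) where
  toFun h := (hash h x, hash h x', hash h x'')
  map_zero' := by simp [hash]
  map_add' h h' := by
    simp only [hash, Prod.fst_add, Prod.snd_add, Matrix.add_mulVec, Prod.mk_add_mk, Prod.mk.injEq]
    refine ⟨?_, ?_, ?_⟩ <;> abel

/-- `evalTripleHom x x' x'' h = (hash h x, hash h x', hash h x'')`. [folklore] -/
@[simp] theorem evalTripleHom_apply (x x' x'' : Fin m → ZMod 2) (h : Hash m k) :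
    evalTripleHom x x' x'' h = (hash h x, hash h x', hash h x'') := rfl

/-- **A matrix with prescribed values on two distinct nonzero vectors over `𝔽₂`.** For `d₁ ≠ d₂`, both
`d₂` nonzero, there is `A` with `A d₁ = 0` and `A d₂ = v`: take a coordinate `i` with `d₂ i = 1`; if
`d₁ i = 0` the single-column matrix at `i` works, otherwise add a second column `v` at a coordinate `j` with
`d₁ j = 1, d₂ j = 0` (which exists since `d₁ ≠ d₂` and, failing an `i` as before, `supp d₂ ⊆ supp d₁`).
[folklore] -/
theorem exists_matrix_mulVec_eq_zero_eq {d₁ d₂ : Fin m → ZMod 2} (h2 : d₂ ≠ 0) (h12 : d₁ ≠ d₂)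
    (v : Fin k → ZMod 2) : ∃ A : Matrix (Fin k) (Fin m) (ZMod 2), A.mulVec d₁ = 0 ∧ A.mulVec d₂ = v := by
  classical
  have eq1 : ∀ {z : ZMod 2}, z ≠ 0 → z = 1 := by decide
  by_cases hi : ∃ i, d₂ i = 1 ∧ d₁ i = 0
  · obtain ⟨i, hi2, hi1⟩ := hi
    refine ⟨colMatrix i v, ?_, ?_⟩
    · rw [colMatrix_mulVec, hi1, zero_smul]
    · rw [colMatrix_mulVec, hi2, one_smul]
  · push Not at hi
    -- `supp d₂ ⊆ supp d₁`; pick `i ∈ supp d₂` and `j ∈ supp d₁ ∖ supp d₂`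
    obtain ⟨i, hi2⟩ : ∃ i, d₂ i ≠ 0 := by
      by_contra hall; push Not at hall; exact h2 (funext hall)
    have hi2' : d₂ i = 1 := eq1 hi2
    have hi1 : d₁ i = 1 := eq1 (hi i hi2')
    obtain ⟨j, hj⟩ : ∃ j, d₁ j ≠ d₂ j := by
      by_contra hall; push Not at hall; exact h12 (funext hall)
    have hj2 : d₂ j = 0 := by
      by_contra h0
      have h21 := eq1 h0
      have h11 := eq1 (hi j h21)
      exact hj (h11.trans h21.symm)
    have hj1 : d₁ j = 1 := by
      have : d₁ j ≠ 0 := fun h0 => hj (by rw [h0, hj2])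
      exact eq1 this
    refine ⟨colMatrix i v + colMatrix j v, ?_, ?_⟩
    · rw [Matrix.add_mulVec, colMatrix_mulVec, colMatrix_mulVec, hi1, hj1, one_smul]
      -- `v + v = 0` over `𝔽₂`
      funext r
      simp only [Pi.add_apply, Pi.zero_apply]
      have : ∀ z : ZMod 2, z + z = 0 := by decide
      exact this _
    · rw [Matrix.add_mulVec, colMatrix_mulVec, colMatrix_mulVec, hi2', hj2, one_smul, zero_smul, add_zero]

/-- **Evaluation at three distinct points is onto** `({0,1}^k)³`: first match `(x, x')` by
`evalPairHom_surjective`, then correct at `x''` by an `(A, A x)`-pair in the kernel of the evaluation at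
`(x, x')` — `A (x' − x) = 0`, `A (x'' − x) = ` the missing difference — which exists by
`exists_matrix_mulVec_eq_zero_eq` (the two difference vectors are distinct and nonzero). Equivalently: any
three distinct vectors `(x,1), (x',1), (x'',1)` are linearly independent over `𝔽₂`. [folklore] -/
theorem evalTripleHom_surjective {x x' x'' : Fin m → ZMod 2} (h1 : x ≠ x') (h2 : x ≠ x'') (h3 : x' ≠ x'') :
    Function.Surjective (evalTripleHom (k := k) x x' x'') := by
  rintro ⟨y, y', y''⟩
  obtain ⟨h₀, hh₀⟩ := evalPairHom_surjective (k := k) h1 (y, y')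
  simp only [evalPairHom_apply, Prod.mk.injEq] at hh₀
  -- the correction
  have hd2 : x'' - x ≠ 0 := sub_ne_zero.2 (Ne.symm h2)
  have hd12 : x' - x ≠ x'' - x := fun h => h3 (sub_left_injective h)
  obtain ⟨A, hA1, hA2⟩ := exists_matrix_mulVec_eq_zero_eq hd2 hd12 (y'' - hash h₀ x'')
  refine ⟨h₀ + (A, -A.mulVec x), ?_⟩
  simp only [evalTripleHom_apply, Prod.mk.injEq]
  have hx : hash (A, -A.mulVec x) x = 0 := by simp [hash]
  have hx' : hash (A, -A.mulVec x) x' = 0 := by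
    simp only [hash]
    rw [Matrix.mulVec_sub] at hA1
    rw [← sub_eq_zero.1 hA1]; abel
  have hx'' : hash (A, -A.mulVec x) x'' = y'' - hash h₀ x'' := by
    rw [Matrix.mulVec_sub] at hA2
    simp only [hash] at hA2 ⊢
    rw [← hA2]; abel
  have hadd : ∀ z, hash (h₀ + (A, -A.mulVec x)) z = hash h₀ z + hash (A, -A.mulVec x) z := fun z => by
    simp only [hash, Prod.fst_add, Prod.snd_add, Matrix.add_mulVec]; abel
  refine ⟨?_, ?_, ?_⟩
  · rw [hadd, hx, add_zero, hh₀.1]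
  · rw [hadd, hx', add_zero, hh₀.2]
  · rw [hadd, hx'']; abel

/-- **Three-wise independence** of affine hashing: for pairwise distinct `x, x', x''` and all targets,
`#{h | h(x) = y ∧ h(x') = y' ∧ h(x'') = y''} · 8^k = |ℋ|`. [folklore] -/
theorem card_filter_hash_triple {x x' x'' : Fin m → ZMod 2} (h1 : x ≠ x') (h2 : x ≠ x'') (h3 : x' ≠ x'')
    (y y' y'' : Fin k → ZMod 2) :
    (univ.filter fun h : Hash m k => hash h x = y ∧ hash h x' = y' ∧ hash h x'' = y'').card *
        (2 ^ k * 2 ^ k * 2 ^ k) = Fintype.card (Hash m k) := by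
  have h := Literature.Computability.AlgebraicComplexity.card_filter_mul_card_eq_card_of_surjective
    (evalTripleHom (k := k) x x' x'') (evalTripleHom_surjective h1 h2 h3) (y, y', y'')
  simpa [Fintype.card_fun, ZMod.card, Fintype.card_prod, Prod.ext_iff, mul_assoc] using h

end AffineHash

end Literature.Computability.Complexity

namespace Literature.Computability.Cryptography

namespace AffineStr

open Finset Complexity Complexity.AffineHash Complexity.Stockmeyer

/-- **Three-wise independence of affine hashing keyed by strings**: for `ℓ ≥ k(m+1)`, pairwise distinct
`x, x', x'' ∈ {0,1}^m` and all targets, `#{σ ∈ {0,1}^ℓ : h_σ x = y ∧ h_σ x' = y' ∧ h_σ x'' = y''} · 8^k = 2^ℓ`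
(equal fibres of the key-reading map, `card_filter_coinHash`, and `card_filter_hash_triple`). [folklore] -/
theorem card_filter_hashV_triple {m k ℓ : ℕ} (hℓ : k * (m + 1) ≤ ℓ) {x x' x'' : List.Vector Bool m}
    (h1 : x ≠ x') (h2 : x ≠ x'') (h3 : x' ≠ x'') (y y' y'' : Fin k → ZMod 2) :
    (univ.filter fun σ : List.Vector Bool ℓ =>
        hashV m k σ.toList x = y ∧ hashV m k σ.toList x' = y' ∧ hashV m k σ.toList x'' = y'').card *
      (2 ^ k * 2 ^ k * 2 ^ k) = 2 ^ ℓ := by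
  have hX1 : toZ x ≠ toZ x' := fun h => h1 (toZ_injective h)
  have hX2 : toZ x ≠ toZ x'' := fun h => h2 (toZ_injective h)
  have hX3 : toZ x' ≠ toZ x'' := fun h => h3 (toZ_injective h)
  have htri : (univ.filter fun h : Hash m k => hash h (toZ x) = y ∧ hash h (toZ x') = y' ∧ hash h (toZ x'') = y'').card *
      (2 ^ k * 2 ^ k * 2 ^ k) = Fintype.card (Hash m k) := by
    convert card_filter_hash_triple (k := k) hX1 hX2 hX3 y y' y'' using 4
  have hfib : (univ.filter fun σ : List.Vector Bool ℓ => hash (coinHash σ.toList m k) (toZ x) = y ∧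
        hash (coinHash σ.toList m k) (toZ x') = y' ∧ hash (coinHash σ.toList m k) (toZ x'') = y'').card *
        Fintype.card (Hash m k) =
      (univ.filter fun h : Hash m k => hash h (toZ x) = y ∧ hash h (toZ x') = y' ∧ hash h (toZ x'') = y'').card * 2 ^ ℓ := by
    convert card_filter_coinHash hℓ (fun h : Hash m k => hash h (toZ x) = y ∧ hash h (toZ x') = y' ∧ hash h (toZ x'') = y'')
      using 4
  have hH := card_hash_pos m k
  show (univ.filter fun σ : List.Vector Bool ℓ => hash (coinHash σ.toList m k) (toZ x) = y ∧
      hash (coinHash σ.toList m k) (toZ x') = y' ∧ hash (coinHash σ.toList m k) (toZ x'') = y'').card *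
      (2 ^ k * 2 ^ k * 2 ^ k) = 2 ^ ℓ
  generalize (univ.filter fun h : Hash m k => hash h (toZ x) = y ∧ hash h (toZ x') = y' ∧ hash h (toZ x'') = y'').card = P
    at htri hfib
  generalize (univ.filter fun σ : List.Vector Bool ℓ => hash (coinHash σ.toList m k) (toZ x) = y ∧
      hash (coinHash σ.toList m k) (toZ x') = y' ∧ hash (coinHash σ.toList m k) (toZ x'') = y'').card = N at hfib ⊢
  refine Nat.eq_of_mul_eq_mul_right hH ?_
  calc N * (2 ^ k * 2 ^ k * 2 ^ k) * Fintype.card (Hash m k)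
      = (N * Fintype.card (Hash m k)) * (2 ^ k * 2 ^ k * 2 ^ k) := by ring
    _ = P * 2 ^ ℓ * (2 ^ k * 2 ^ k * 2 ^ k) := by rw [hfib]
    _ = (P * (2 ^ k * 2 ^ k * 2 ^ k)) * 2 ^ ℓ := by ring
    _ = 2 ^ ℓ * Fintype.card (Hash m k) := by rw [htri, Nat.mul_comm]

/-- The pairwise count in the same explicit form (`isPairwiseIndep_hashV` unfolded on `univ`). [folklore] -/
theorem card_filter_hashV_pair {m k ℓ : ℕ} (hℓ : k * (m + 1) ≤ ℓ) {x x' : List.Vector Bool m} (h1 : x ≠ x')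
    (y y' : Fin k → ZMod 2) :
    (univ.filter fun σ : List.Vector Bool ℓ => hashV m k σ.toList x = y ∧ hashV m k σ.toList x' = y').card *
      (2 ^ k * 2 ^ k) = 2 ^ ℓ := by
  have h := isPairwiseIndep_hashV hℓ (univ : Finset (List.Vector Bool m)) x (Finset.mem_univ _) x'
    (Finset.mem_univ _) h1 y y'
  rw [Fintype.card_fun, ZMod.card, Fintype.card_fin, Finset.card_univ, card_vector, Fintype.card_bool, sq] at h
  exact h

end AffineStr

/-! ### Hashed prefixes: equal-size prefix classes, and the counting hypotheses of Theorem 4.5 -/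

namespace HHRVW

open Finset

/-- The `i`-prefix of a hash value `v ∈ 𝔽₂^k`, as the value with the coordinates `≥ i` zeroed (so
"equal `i`-prefixes" is equality of `prefixZ i`). [cite: HaitnerEtAl2020, Thm. 4.5 (the truncation `g(f(x))_{1..i}`)] -/
def prefixZ {k : ℕ} (i : ℕ) (v : Fin k → ZMod 2) : Fin k → ZMod 2 := fun j => if (j : ℕ) < i then v j else 0

/-- Equal `i`-prefixes means agreement on the coordinates below `i`. [folklore] -/
theorem prefixZ_eq_iff {k : ℕ} {i : ℕ} {v w : Fin k → ZMod 2} :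
    prefixZ i v = prefixZ i w ↔ ∀ j : Fin k, (j : ℕ) < i → v j = w j := by
  constructor
  · intro h j hj
    have := congrFun h j
    simp only [prefixZ, hj, if_true] at this
    exact this
  · intro h
    funext j
    simp only [prefixZ]
    split_ifs with hj
    · exact h j hj
    · rfl

/-- **Prefix classes have `2^{k-i}` elements**: for `i ≤ k`, `#{v ∈ 𝔽₂^k : prefixZ i v = prefixZ i w} · 2^i = 2^k`.
[folklore] -/
theorem card_filter_prefixZ_eq_mul {k i : ℕ} (hi : i ≤ k) (w : Fin k → ZMod 2) :
    ((univ : Finset (Fin k → ZMod 2)).filter fun v => prefixZ i v = prefixZ i w).card * 2 ^ i = 2 ^ k := by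
  classical
  have hset : ((univ : Finset (Fin k → ZMod 2)).filter fun v => prefixZ i v = prefixZ i w) =
      Fintype.piFinset fun j : Fin k => if (j : ℕ) < i then ({w j} : Finset (ZMod 2)) else univ := by
    ext v
    simp only [Finset.mem_filter, Finset.mem_univ, true_and, Fintype.mem_piFinset, prefixZ_eq_iff]
    constructor
    · intro h j
      split_ifs with hj
      · exact Finset.mem_singleton.2 (h j hj)
      · exact Finset.mem_univ _
    · intro h j hj
      have := h j
      rw [if_pos hj, Finset.mem_singleton] at this
      exact this
  rw [hset, Fintype.card_piFinset]
  have hprod : (∏ j : Fin k, (if (j : ℕ) < i then ({w j} : Finset (ZMod 2)) else univ).card) =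
      ∏ j : Fin k, (if (j : ℕ) < i then 1 else 2) := by
    refine Finset.prod_congr rfl fun j _ => ?_
    split_ifs <;> simp [ZMod.card]
  rw [hprod, Finset.prod_ite, Finset.prod_const_one, one_mul, Finset.prod_const]
  have hlt : ((univ : Finset (Fin k)).filter fun j : Fin k => j.val < i).card = i := by
    have := Fin.card_filter_val_lt (n := k) (m := i)
    rw [Nat.min_eq_right hi] at this
    convert this using 2
  have hcard : ((univ : Finset (Fin k)).filter fun j : Fin k => ¬ j.val < i).card = k - i := by
    have h := Finset.card_filter_add_card_filter_not (s := (univ : Finset (Fin k))) (fun j : Fin k => j.val < i)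
    rw [hlt, Finset.card_univ, Fintype.card_fin] at h
    omega
  rw [hcard, ← pow_add, Nat.sub_add_cancel hi]

/-- **From two-point uniformity to prefix agreement.** If the pair `(u κ, u' κ)` is uniform on `(𝔽₂^k)²`
over the key (`#{κ : u κ = z ∧ u' κ = z'} · 4^k = |K|` for all targets), then the `i`-prefixes agree for
exactly a `2^{-i}` fraction of the keys (`i ≤ k`). [cite: HaitnerEtAl2020, proof of Claim 4.6, Eq. (4.9) ("since `G` is two-wise independent")] -/
theorem card_filter_prefixZ_agree_mul {K : Type*} [Fintype K] {k i : ℕ} (hi : i ≤ k)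
    (u u' : K → (Fin k → ZMod 2))
    (hpair : ∀ z z' : Fin k → ZMod 2,
      ((univ : Finset K).filter fun κ => u κ = z ∧ u' κ = z').card * (2 ^ k * 2 ^ k) = Fintype.card K) :
    ((univ : Finset K).filter fun κ => prefixZ i (u' κ) = prefixZ i (u κ)).card * 2 ^ i = Fintype.card K := by
  classical
  -- decompose the count along the values `(z, z') = (u κ, u' κ)`
  have hQ : ((univ : Finset K).filter fun κ => prefixZ i (u' κ) = prefixZ i (u κ)).card =
      ∑ z : Fin k → ZMod 2, ∑ z' : Fin k → ZMod 2, (if prefixZ i z' = prefixZ i z then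
        ((univ : Finset K).filter fun κ => u κ = z ∧ u' κ = z').card else 0) := by
    set S := (univ : Finset K).filter fun κ => prefixZ i (u' κ) = prefixZ i (u κ) with hS
    rw [Finset.card_eq_sum_card_fiberwise (f := u) (s := S) (t := univ) fun _ _ => Finset.mem_univ _]
    refine Finset.sum_congr rfl fun z _ => ?_
    rw [Finset.card_eq_sum_card_fiberwise (f := u') (s := S.filter fun κ => u κ = z) (t := univ)
      fun _ _ => Finset.mem_univ _]
    refine Finset.sum_congr rfl fun z' _ => ?_
    by_cases hp : prefixZ i z' = prefixZ i z
    · rw [if_pos hp]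
      congr 1
      ext κ
      simp only [hS, Finset.mem_filter, Finset.mem_univ, true_and]
      constructor
      · rintro ⟨⟨-, hz⟩, hz'⟩; exact ⟨hz, hz'⟩
      · rintro ⟨hz, hz'⟩; exact ⟨⟨by rw [hz, hz']; exact hp, hz⟩, hz'⟩
    · rw [if_neg hp, Finset.card_eq_zero, Finset.filter_eq_empty_iff]
      intro κ hκ hz'
      simp only [hS, Finset.mem_filter, Finset.mem_univ, true_and] at hκ
      apply hp
      rw [← hz', ← hκ.2]; exact hκ.1
  -- multiply out
  have hmul : ((univ : Finset K).filter fun κ => prefixZ i (u' κ) = prefixZ i (u κ)).card * (2 ^ k * 2 ^ k) * 2 ^ i =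
      Fintype.card K * (2 ^ k * 2 ^ k) := by
    rw [hQ, Finset.sum_mul, Finset.sum_mul]
    have hz : ∀ z : Fin k → ZMod 2, (∑ z' : Fin k → ZMod 2, (if prefixZ i z' = prefixZ i z then
        ((univ : Finset K).filter fun κ => u κ = z ∧ u' κ = z').card else 0)) * (2 ^ k * 2 ^ k) * 2 ^ i =
        Fintype.card K * 2 ^ k := by
      intro z
      rw [← Finset.sum_filter, Finset.sum_mul, Finset.sum_congr rfl fun z' _ => hpair z z', Finset.sum_const,
        smul_eq_mul]
      calc ((univ : Finset (Fin k → ZMod 2)).filter fun z' => prefixZ i z' = prefixZ i z).card * Fintype.card K * 2 ^ i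
          = (((univ : Finset (Fin k → ZMod 2)).filter fun z' => prefixZ i z' = prefixZ i z).card * 2 ^ i) * Fintype.card K := by
            ring
        _ = 2 ^ k * Fintype.card K := by rw [card_filter_prefixZ_eq_mul hi z]
        _ = Fintype.card K * 2 ^ k := by ring
    rw [Finset.sum_congr rfl fun z _ => hz z, Finset.sum_const, Finset.card_univ, smul_eq_mul, Fintype.card_fun,
      ZMod.card, Fintype.card_fin]
    ring
  have hpos : 0 < 2 ^ k * 2 ^ k := by positivity
  refine Nat.eq_of_mul_eq_mul_right hpos ?_
  calc ((univ : Finset K).filter fun κ => prefixZ i (u' κ) = prefixZ i (u κ)).card * 2 ^ i * (2 ^ k * 2 ^ k)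
      = ((univ : Finset K).filter fun κ => prefixZ i (u' κ) = prefixZ i (u κ)).card * (2 ^ k * 2 ^ k) * 2 ^ i := by ring
    _ = Fintype.card K * (2 ^ k * 2 ^ k) := hmul

/-- **From three-point uniformity to double prefix agreement**: if `(u κ, u' κ, u'' κ)` is uniform on
`(𝔽₂^k)³` over the key, then both `u'` and `u''` agree with `u` on the `i`-prefix for exactly a `4^{-i}`
fraction of the keys (`i ≤ k`). [cite: HaitnerEtAl2020, Claim 4.8, Eq. (4.11) ("by the three-wise independence of `G`")] -/
theorem card_filter_prefixZ_agree_two_mul {K : Type*} [Fintype K] {k i : ℕ} (hi : i ≤ k)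
    (u u' u'' : K → (Fin k → ZMod 2))
    (htri : ∀ z z' z'' : Fin k → ZMod 2,
      ((univ : Finset K).filter fun κ => u κ = z ∧ u' κ = z' ∧ u'' κ = z'').card * (2 ^ k * 2 ^ k * 2 ^ k) =
        Fintype.card K) :
    ((univ : Finset K).filter fun κ => prefixZ i (u' κ) = prefixZ i (u κ) ∧ prefixZ i (u'' κ) = prefixZ i (u κ)).card *
      4 ^ i = Fintype.card K := by
  classical
  have hQ : ((univ : Finset K).filter fun κ => prefixZ i (u' κ) = prefixZ i (u κ) ∧ prefixZ i (u'' κ) = prefixZ i (u κ)).card =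
      ∑ z : Fin k → ZMod 2, ∑ z' : Fin k → ZMod 2, ∑ z'' : Fin k → ZMod 2,
        (if prefixZ i z' = prefixZ i z ∧ prefixZ i z'' = prefixZ i z then
          ((univ : Finset K).filter fun κ => u κ = z ∧ u' κ = z' ∧ u'' κ = z'').card else 0) := by
    set S := (univ : Finset K).filter fun κ => prefixZ i (u' κ) = prefixZ i (u κ) ∧ prefixZ i (u'' κ) = prefixZ i (u κ)
      with hS
    rw [Finset.card_eq_sum_card_fiberwise (f := u) (s := S) (t := univ) fun _ _ => Finset.mem_univ _]
    refine Finset.sum_congr rfl fun z _ => ?_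
    rw [Finset.card_eq_sum_card_fiberwise (f := u') (s := S.filter fun κ => u κ = z) (t := univ)
      fun _ _ => Finset.mem_univ _]
    refine Finset.sum_congr rfl fun z' _ => ?_
    rw [Finset.card_eq_sum_card_fiberwise (f := u'') (s := (S.filter fun κ => u κ = z).filter fun κ => u' κ = z')
      (t := univ) fun _ _ => Finset.mem_univ _]
    refine Finset.sum_congr rfl fun z'' _ => ?_
    by_cases hp : prefixZ i z' = prefixZ i z ∧ prefixZ i z'' = prefixZ i z
    · rw [if_pos hp]
      congr 1
      ext κ
      simp only [hS, Finset.mem_filter, Finset.mem_univ, true_and]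
      constructor
      · rintro ⟨⟨⟨-, hz⟩, hz'⟩, hz''⟩; exact ⟨hz, hz', hz''⟩
      · rintro ⟨hz, hz', hz''⟩
        exact ⟨⟨⟨by rw [hz, hz', hz'']; exact hp, hz⟩, hz'⟩, hz''⟩
    · rw [if_neg hp, Finset.card_eq_zero, Finset.filter_eq_empty_iff]
      intro κ hκ hz''
      simp only [hS, Finset.mem_filter, Finset.mem_univ, true_and] at hκ
      apply hp
      obtain ⟨⟨hpre, hz⟩, hz'⟩ := hκ
      rw [← hz, ← hz', ← hz'']; exact hpre
  have hmul : ((univ : Finset K).filter fun κ => prefixZ i (u' κ) = prefixZ i (u κ) ∧ prefixZ i (u'' κ) = prefixZ i (u κ)).card *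
      (2 ^ k * 2 ^ k * 2 ^ k) * 4 ^ i = Fintype.card K * (2 ^ k * 2 ^ k * 2 ^ k) := by
    rw [hQ, Finset.sum_mul, Finset.sum_mul]
    have hcls := card_filter_prefixZ_eq_mul hi
    have hz : ∀ z : Fin k → ZMod 2, (∑ z' : Fin k → ZMod 2, ∑ z'' : Fin k → ZMod 2,
        (if prefixZ i z' = prefixZ i z ∧ prefixZ i z'' = prefixZ i z then
          ((univ : Finset K).filter fun κ => u κ = z ∧ u' κ = z' ∧ u'' κ = z'').card else 0)) *
          (2 ^ k * 2 ^ k * 2 ^ k) * 4 ^ i = Fintype.card K * (2 ^ k * 2 ^ k) := by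
      intro z
      -- restrict both inner sums to the prefix classes of `z`
      have hin : (∑ z' : Fin k → ZMod 2, ∑ z'' : Fin k → ZMod 2,
          (if prefixZ i z' = prefixZ i z ∧ prefixZ i z'' = prefixZ i z then
            ((univ : Finset K).filter fun κ => u κ = z ∧ u' κ = z' ∧ u'' κ = z'').card else 0)) * (2 ^ k * 2 ^ k * 2 ^ k) =
          ((univ : Finset (Fin k → ZMod 2)).filter fun v => prefixZ i v = prefixZ i z).card *
            (((univ : Finset (Fin k → ZMod 2)).filter fun v => prefixZ i v = prefixZ i z).card * Fintype.card K) := by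
        rw [Finset.sum_mul]
        have h1 : ∀ z' : Fin k → ZMod 2, (∑ z'' : Fin k → ZMod 2,
            (if prefixZ i z' = prefixZ i z ∧ prefixZ i z'' = prefixZ i z then
              ((univ : Finset K).filter fun κ => u κ = z ∧ u' κ = z' ∧ u'' κ = z'').card else 0)) * (2 ^ k * 2 ^ k * 2 ^ k) =
            if prefixZ i z' = prefixZ i z then
              ((univ : Finset (Fin k → ZMod 2)).filter fun v => prefixZ i v = prefixZ i z).card * Fintype.card K else 0 := by
          intro z'
          split_ifs with hz'
          · rw [Finset.sum_mul]
            have h2 : ∀ z'' : Fin k → ZMod 2, (if prefixZ i z' = prefixZ i z ∧ prefixZ i z'' = prefixZ i z then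
                ((univ : Finset K).filter fun κ => u κ = z ∧ u' κ = z' ∧ u'' κ = z'').card else 0) * (2 ^ k * 2 ^ k * 2 ^ k) =
                if prefixZ i z'' = prefixZ i z then Fintype.card K else 0 := by
              intro z''
              split_ifs with hz'' <;> first | exact htri z z' z'' | (exfalso; tauto) | simp
            rw [Finset.sum_congr rfl fun z'' _ => h2 z'', ← Finset.sum_filter, Finset.sum_const, smul_eq_mul]
          · rw [Finset.sum_mul]
            refine Finset.sum_eq_zero fun z'' _ => ?_
            rw [if_neg (fun h => hz' h.1), zero_mul]
        rw [Finset.sum_congr rfl fun z' _ => h1 z', ← Finset.sum_filter, Finset.sum_const, smul_eq_mul]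
      rw [hin]
      have h4 : (4 : ℕ) ^ i = 2 ^ i * 2 ^ i := by rw [← mul_pow]; norm_num
      rw [h4]
      calc ((univ : Finset (Fin k → ZMod 2)).filter fun v => prefixZ i v = prefixZ i z).card *
            (((univ : Finset (Fin k → ZMod 2)).filter fun v => prefixZ i v = prefixZ i z).card * Fintype.card K) * (2 ^ i * 2 ^ i)
          = (((univ : Finset (Fin k → ZMod 2)).filter fun v => prefixZ i v = prefixZ i z).card * 2 ^ i) *
              (((univ : Finset (Fin k → ZMod 2)).filter fun v => prefixZ i v = prefixZ i z).card * 2 ^ i) * Fintype.card K := by ring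
        _ = 2 ^ k * 2 ^ k * Fintype.card K := by rw [hcls z]
        _ = Fintype.card K * (2 ^ k * 2 ^ k) := by ring
    rw [Finset.sum_congr rfl fun z _ => hz z, Finset.sum_const, Finset.card_univ, smul_eq_mul, Fintype.card_fun,
      ZMod.card, Fintype.card_fin]
    ring
  have hpos : 0 < 2 ^ k * 2 ^ k * 2 ^ k := by positivity
  refine Nat.eq_of_mul_eq_mul_right hpos ?_
  calc ((univ : Finset K).filter fun κ => prefixZ i (u' κ) = prefixZ i (u κ) ∧ prefixZ i (u'' κ) = prefixZ i (u κ)).card *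
        4 ^ i * (2 ^ k * 2 ^ k * 2 ^ k)
      = ((univ : Finset K).filter fun κ => prefixZ i (u' κ) = prefixZ i (u κ) ∧ prefixZ i (u'' κ) = prefixZ i (u κ)).card *
          (2 ^ k * 2 ^ k * 2 ^ k) * 4 ^ i := by ring
    _ = Fintype.card K * (2 ^ k * 2 ^ k * 2 ^ k) := hmul

/-! ### The hashed-prefix map of Theorem 4.5 over the string-keyed affine family -/

open AffineStr

/-- **The hashed `i`-prefix of Theorem 4.5, concretely**: key `σ ∈ {0,1}^ℓ`, image `y` first padded
injectively into `{0,1}^P` (`pad`), hashed by the affine map `h_σ : {0,1}^P → 𝔽₂^k`, then truncated to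
its `i`-prefix. [cite: HaitnerEtAl2020, Thm. 4.5 (`F(x,g,i) = (g(f(x))_{1,…,i}, g, i)`)] -/
def affinePrefix {𝒴 : Type*} (P k ℓ : ℕ) (pad : 𝒴 → List.Vector Bool P) (σ : List.Vector Bool ℓ) (i : ℕ) (y : 𝒴) :
    Fin k → ZMod 2 :=
  prefixZ i (hashV P k σ.toList (pad y))

/-- **`PrefixPairwise` for the affine hashed prefix** (`ℓ ≥ k(P+1)`, prefix lengths `< M ≤ k+1`, `pad`
injective on images). [cite: HaitnerEtAl2020, §2.4 with Thm. 4.5] -/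
theorem prefixPairwise_affinePrefix {𝒳 𝒴 : Type*} (f : 𝒳 → 𝒴) {P k ℓ M : ℕ} (hℓ : k * (P + 1) ≤ ℓ)
    (hM : M ≤ k + 1) (pad : 𝒴 → List.Vector Bool P) (hpad : ∀ x x', f x ≠ f x' → pad (f x) ≠ pad (f x')) :
    PrefixPairwise f (affinePrefix P k ℓ pad) M := by
  intro i hi x x' hne
  have hi' : i ≤ k := by omega
  have h := card_filter_prefixZ_agree_mul hi' (fun σ : List.Vector Bool ℓ => hashV P k σ.toList (pad (f x)))
    (fun σ => hashV P k σ.toList (pad (f x'))) (fun z z' => by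
      rw [card_vector, Fintype.card_bool]; exact card_filter_hashV_pair hℓ (hpad x x' hne) z z')
  exact h

/-- **`PrefixThreewise` for the affine hashed prefix** (`ℓ ≥ k(P+1)`, prefix lengths `< M ≤ k+1`, `pad`
injective on images). [cite: HaitnerEtAl2020, §2.4 with Thm. 4.5] -/
theorem prefixThreewise_affinePrefix {𝒳 𝒴 : Type*} (f : 𝒳 → 𝒴) {P k ℓ M : ℕ} (hℓ : k * (P + 1) ≤ ℓ)
    (hM : M ≤ k + 1) (pad : 𝒴 → List.Vector Bool P) (hpad : ∀ x x', f x ≠ f x' → pad (f x) ≠ pad (f x')) :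
    PrefixThreewise f (affinePrefix P k ℓ pad) M := by
  intro i hi x x' x'' h1 h2 h3
  have hi' : i ≤ k := by omega
  have h := card_filter_prefixZ_agree_two_mul hi' (fun σ : List.Vector Bool ℓ => hashV P k σ.toList (pad (f x)))
    (fun σ => hashV P k σ.toList (pad (f x'))) (fun σ => hashV P k σ.toList (pad (f x''))) (fun z z' z'' => by
      rw [card_vector, Fintype.card_bool]
      exact card_filter_hashV_triple hℓ (hpad x x' h1) (hpad x x'' h2) (hpad x' x'' h3) z z' z'')
  exact h

end HHRVW

end Literature.Computability.Cryptography
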